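import Mathlib
import Literature.NumberTheory.LFunctions.Zhang2022.SkeletonPartThree
import Literature.NumberTheory.LFunctions.Zhang2022.Section18Defs
import HarnessLib

/-!
# Zhang (2022) §12c, typed statements: the evaluations of `Θ₁(𝐚₁₂,𝐚₂₅)` and `Θ₁(𝐚₁₅,𝐚₂₂)`,
# (12.12)–(12.17) (PDF pp. 71–73, tex L3595–L3719)

Topic `Literature/NumberTheory/LFunctions/Zhang2022` (Landau–Siegel audit tree; verdict-neutral).
Y. Zhang, *Discrete mean estimates and the Landau–Siegel zero*, arXiv:2211.02515v1 (2022)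
[Zhang2022LandauSiegel] — **an unrefereed manuscript under adjudication; every `def … : Prop` below is
a CLAIM OF THE MANUSCRIPT, STATED NOT ASSERTED.** Campaign D-0069 (statement typing), file
`TypedSection12C` = §12 third part, DAG nodes `Z22:§12.u035 … Z22:(12.17)` of `plan/DAG.tsv`
(23 nodes), one declaration (or one object + one claim) per node, locators
`[Z22 p.<PDF page>, (<display>), tex L<line>]` read on the page (`sources/zhang2022/pages/p0071–p0073.txt`)
and in the TeX source (`lsz3__2_.tex`).

## What is typed, and how

The block evaluates the two mean values of (12.9), `Θ₁(𝐚₁₂,𝐚₂₅)` and `Θ₁(𝐚₁₅,𝐚₂₂)`, through the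
arithmetic sums `S_j(𝐚₁,𝐚₂)` of Proposition 7.1 (the skeleton's `Skeleton.Sj`), split according to the
size of `dr` (`dr ≤ P″₁/T`, `P″₁/T < dr ≤ P″₁`, `P″₁ < dr < P₂`; here `SjOn … R` is `S_j` restricted to
the pairs `(d,r)` with `R(dr)`), and evaluated by Lemmas 8.2–8.4, 12.1–12.3 into window sums
`Σ_{P^a<n<P^b} |χ(n)|λ₀ⱼ(n)φ(n)⁻¹(…)` and then into the integrals that define the constants
`e*_{1j}, e₁*, e₂*` of the tree (`Section18Defs.estar1/estar11–13/e1star/e2star`, CITED, not redefined).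

| node | locator | decl(s) | printed claim |
|---|---|---|---|
| `Z22:§12.u035` | p.71 L3600 | `sj1225rhs`, `Step12u035` | the expansion of `S_j(𝐚₁₂,𝐚₂₅)` |
| (sentence) | p.71 L3605 | `Mid1225` | "the sum over `P″₁/T < dr ≤ P″₁` contributes `o(α)`" |
| `Z22:(12.12)` | p.71 L3607 | `main1212sum`, `main1212int`, `Eq1212` | the sum over `dr ≤ P″₁/T` `= … + o(α) = 𝔞b*(log P)β_{j+1}β_{j+2}∫₀^{0.496}(…)dz + o(α)` |
| `Z22:(12.13)` | p.71 L3614 | `main1213sum`, `maj1213sum`, `main1213int`, `maj1213int`, `Eq1213` | the sum over `P″₁ < dr < P₂` `= … 𝓦_j(n) … + o(α) = … ∫ … 𝓦_j(P^z)dz + o(α)` |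
| `Z22:§12.u036` | p.71 L3624 | `frakw0`, `frakw` | `𝓦_j(n) = −1 + (−2β₆+β_{j+1}+β_{j+2})log(n/P″₁) + ε_{2j}(n)` |
| `Z22:§12.u037` | p.71 L3628 | `apprF6`, `Step12u037` | "`𝔣_{j6}(z) ≈ 1 + πi(3−j)z ≃ 1 + (2β₆−β_j)(log P)z`" |
| `Z22:§12.u038` | p.72 L3632 | `Step12u038` | "`4β₆ − β₁ − β₂ − β₃ ≃ 0`" |
| `Z22:§12.u039` | p.72 L3636 | `Step12u039` | "`∫_{0.496}^{0.498} 𝔣_{j6}(0.498−z)𝓦_j(P^z)dz = −0.002 + ε/10`" (NUM:N-07) |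
| `Z22:§12.u040` | p.72 L3640 | `apprF7`, `Step12u040` | "`𝔣_{j7}(z) ≈ 1 + πi(5−j)z ≃ 1 + (2β₇−β_j)(log P)z`" |
| `Z22:§12.u041` | p.72 L3644 | `apprFW7` | the linear approximant of `𝔣_{j7}(0.5−z)𝓦_j(P^z)` |
| `Z22:§12.u042` | p.72 L3648 | `Step12u042` | "`(2β₆+2β₇−β₁−β₂−β₃)log P ≃ 2πi`" |
| `Z22:§12.u043` | p.72 L3652 | `Step12u043` | "`∫_{0.496}^{0.5} 𝔣_{j6}[sic](0.5−z)𝓦_j(P^z)dz = −0.004 − πi/250² + ε/10`" (NUM:N-07) |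
| `Z22:(12.14)` | p.72 L3656 | `main1214`, `Eq1214` | the sum over `P″₁ < dr < P₂` `= 𝔞/(0.504 log P)(−0.002ῑ₃/0.498 − 0.008ῑ₄ − 2πiῑ₄/250² + ε/4)` |
| `Z22:(12.15)` | p.72 L3660 | `Eq1215` | `(1/2α)S₁ + (2/α)S₂ + (3/2α)S₃ (𝐚₁₂,𝐚₂₅) = 𝔞(e₁* + e₂* + ε/2)` (NUM:N-08) |
| `Z22:§12.u044` | p.72 L3664 | `e1star_eq_estar1j` | `e₁* = −πb*(3e*₁₁ + 6e*₁₂ + 3e*₁₃)` = tree `e1star` |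
| `Z22:§12.u045` | p.72 L3668 | `estar1j`, `estar1j_one/two/three` | `e*_{1j} = ∫₀^{0.496}(ῑ₃𝔣𝔣_{j6}(0.498−z)/0.498 + ῑ₄𝔣𝔣_{j7}(0.5−z)/0.5)dz` = tree `estar1` |
| `Z22:§12.u046` | p.72 L3672 | `e2star_eq_bracket` | `e₂* = (4/(0.504π))(−0.002ῑ₃/0.498 − 0.008ῑ₄ − 2πiῑ₄/250²)` = tree `e2star` |
| `Z22:§12.u047` | p.73 L3683 | `sj1522rhs`, `Step12u047` | the expansion of `S_j(𝐚₁₅,𝐚₂₂)` |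
| (sentence) | p.73 L3688 | `Low1522` | "the first sum [`dr ≤ P″₁`] contributes `o(α)`" |
| `Z22:§12.u048` | p.73 L3690 | `Step12u048` | "the second sum is equal to `𝔞b*∫₀^{0.496}(ῑ₃𝔣𝔣_{j6}(0.498−z)+ῑ₄𝔣𝔣_{j6}(0.5−z))dz + o(α)`" (VERBATIM; see the caveat) |
| `Z22:§12.u049` | p.73 L3694 | `main12u049sum`, `maj12u049sum`, `main12u049int`, `maj12u049int`, `Step12u049` | the sum over `P″₁ < dr < P₂` of `S_j(𝐚₁₅,𝐚₂₂)` via `𝓖_{jμ}`, `𝓦*_j` |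
| `Z22:§12.u050` | p.73 L3704 | `frakwStar0`, `frakwStar` | `𝓦*_j(n) = −1 + (2β₆−β_j)log(n/P″₁) + ε_{1j}(n)` |
| `Z22:§12.u051` | p.73 L3708 | `apprG`, `Step12u051` | "`𝔤𝔥_{jμ}(z)` is well-approximated by `1 − (2β_μ−β_{j+1}−β_{j+2})(log P)z`" |
| `Z22:(12.16)` | p.73 L3710 | `Eq1216` | `(1/2α)S₁(𝐚₁₅,𝐚₂₃[sic]) + (2/α)S₂ + (3/2α)S₃ (𝐚₁₅,𝐚₂₂) = 𝔞(ē₂* + ε/2)` (NUM:N-08) |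
| `Z22:(12.17)` | p.73 L3715 | (banked `Skeleton.Eval1217 c′`, `Skeleton.Ded1217 c′`, p409865) + `Ded1217fine` | "Finally, by (12.9), (12.15) and (12.16) we conclude (12.17)" |

Conventions (L3 §0). `c′` is the parameter of (2.13) as in the skeleton. "`= main + o(α)`" under the
standing hypotheses (Assumption (A), `D` large, `1 ≤ j ≤ 3` — "Assume `1 ≤ j ≤ 3` in what follows", p. 68) is
typed `∀ ε > 0, ForAllLarge fun D _ χ => AssumptionA D χ → … ‖lhs − main‖ ≤ ε·α`. The manuscript's `ε`
(pp. 71–73) is its generic quantity of modulus `< 10⁻⁵` (Lemmas 12.1, 12.3, §8 p. 50): "`+ ε/10`", "`+ ε/4`",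
"`+ ε/2`" are typed as slacks of modulus `≤ 10⁻⁶`, `≤ 10⁻⁵/4`, `≤ 10⁻⁵/2` — BOUNDS, never equations. The
functions `ε_{2j}(·)` (Lemma 12.3) and `ε_{1j}(·)` (Lemma 12.1) inside `𝓦_j`, `𝓦*_j` are defined by the
manuscript only implicitly (and written as functions of the product `dr`); the objects `frakw`, `frakwStar`
take them as an explicit function argument, and every CLAIM is typed on the explicit parts `frakw0`,
`frakwStar0` with the `ε`-part carried as an additive slack `10⁻⁵ ×` (the same expression with absolute
values) — exactly what the triangle inequality extracts from the printed sentence, in the form the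
skeleton already uses for Lemmas 12.1/12.3 and (12.17). "`≃`" between `D`-dependent numbers and constants
(pp. 71–72) is typed as the limit statement `∀ ε > 0, ForAllLarge …, ‖lhs − rhs‖ ≤ ε`, scaled by `log P`
where the text uses the relation at that scale (said in each docstring); "a good approximation to
`𝔣_{jμ}(z)` is `1 + cz`" is typed as the exact first-order Taylor data at `0` of the tree's closed
forms (value `1`, derivative `c`), the only precise content of the sentence; the numerical USE of
these approximations is the two `NUM` nodes u039/u043 (plan/NUMERICS.tsv N-07; read1's prior on them is
not adjudicated here).

Objects of other L3 files are NOT declared here (L3 ASSIGNMENTS §1b): `𝐚₁₅`, `𝐚₂₅` (TypedSection12A,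
L3-t4) enter as explicit function arguments `a15 a25 : ℕ → ℂ` constrained by their printed definitions
"`a₁₅(n) = χ(n)ϰ₁₃(n)`, `a₂₅(n) = conj a₁₅(n)`" (display after (12.9), p. 68; `ϰ₁₃` = the tree's
`Skeleton.vk13`); the discharger instantiates them with L3-t4's declarations. Tree objects used by name:
`Skeleton.Sj/lamZero/xiZero/betaJ/Nsupp` (§7), `Skeleton.frakfW/frakgW/betaMu/PiW` (§8), `Skeleton.a12/a22`
(9.2), `Skeleton.vk13/P1pp/P2pp/Lemma121/Lemma123/Eval1217/Ded1217` (§12), `Skeleton.frakA` (2.31),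
`Section8Defs.ff16…gh37`, `Section18Defs.iota3/iota4/bstar/estar1/estar11–13/e1star/e2star`. The
`j`-indexed accessors `ffj`, `ghj`, `estar1j` are bridges to those (definitionally equal, `rfl` lemmas
below), not new constants.

Printed slips recorded, not resolved (each decl says which reading it types): `ϰ̄₁₃(n)` for `ϰ̄₁₃(drn)`
and `ϰ₁₃(m)` for `ϰ₁₃(drm)` in the two `S_j` expansions (pp. 71, 73; cf. the generic `S_j` of Prop. 7.1
and Lemmas 12.1–12.3, whose sums run over `ϰ₁₃(dl)`, `ϰ̄₁₃(drl)`); `𝔣_{j6}(0.5−z)` for `𝔣_{j7}(0.5−z)` in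
u043 (p. 72: the preceding sentence approximates `𝔣_{j7}(0.5−z)𝓦_j(P^z)` on `[0.496, 0.5]`);
`S₁(𝐚₁₅,𝐚₂₃)` for `S₁(𝐚₁₅,𝐚₂₂)` in (12.16); `𝓦*(n)` for `𝓦*_j(n)` (p. 73); and the p. 73 sentence
"The sum is split into two sums according to `dr ≤ P″₁` and `P″₁ < dr < P₂`. … the first sum
contributes `o(α)`; the second sum is equal to `𝔞b*∫₀^{0.496}(ῑ₃𝔣𝔣_{j6}(0.498−z)+ῑ₄𝔣𝔣_{j6}(0.5−z))dz + o(α)`.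
By lemma 8.2, 8.3 and 12.3, the sum over `P″₁ < dr < P₂` is equal to [u049]" evaluates the SAME sum
twice with different results; (12.16) (no `b*`-term) uses u049 only. u048 is typed verbatim
(`Step12u048`) and flagged to the L3 lead as a GAP-LEDGER candidate (editing remnant of (12.12), scale
`𝔞b*` instead of `𝔞b*(log P)β_{j+1}β_{j+2}`); nothing below depends on it.

What is deliberately NOT here: (12.1)–(12.11), Lemmas 12.1–12.3 and their proofs (TypedSection12A/B and
the skeleton), any evaluation of the constants (tree `Section18Certificate`), and any statement about
Propositions 2.4–2.6 or Theorems 1–2 of the manuscript.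

## References

* Y. Zhang, arXiv:2211.02515v1 (2022), §12 pp. 71–73, (12.12)–(12.17); §7 Prop. 7.1 p. 33; §8
  Lemmas 8.2–8.4 pp. 45–46, (8.10) p. 47, (8.13)–(8.18) p. 48; Lemmas 12.1–12.3 pp. 68–71.
  [cite: Zhang2022LandauSiegel, §12 (12.12)–(12.17)]
-/

noncomputable section

open Complex Real ComplexConjugate

namespace Literature.NumberTheory.LFunctions.Zhang2022.Typed.Sec12C

open Literature.NumberTheory.LFunctions.Zhang2022.Skeleton

/-! ## Bridges to the tree's closed forms `𝔣𝔣_{jμ}`, `𝔤𝔥_{jμ}` ((8.13)–(8.18)) and `e*_{1j}` -/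

/-- `Z22:(8.13)–(8.18)` bridge. `𝔣𝔣_{jμ}` ((8.13)–(8.18), p. 48) as a `j, μ`-indexed family: the tree's `ff16, ff26, ff36, ff17, ff27,
ff37` (`Section8Defs`); junk value `0` outside `j ∈ {1,2,3}`, `μ ∈ {6,7}`. A bridge, not a new object.
[cite: Zhang2022LandauSiegel, §8 (8.13)–(8.18) p.48] -/
def ffj : ℕ → ℕ → ℝ → ℂ
  | 1, 6 => ff16
  | 2, 6 => ff26
  | 3, 6 => ff36
  | 1, 7 => ff17
  | 2, 7 => ff27
  | 3, 7 => ff37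
  | _, _ => fun _ => 0

/-- `Z22:(8.13)–(8.18)` bridge. `𝔤𝔥_{jμ}` ((8.13)–(8.18), p. 48) as a `j, μ`-indexed family: the tree's `gh16 … gh37`; junk `0`
elsewhere. A bridge, not a new object. [cite: Zhang2022LandauSiegel, §8 (8.13)–(8.18) p.48] -/
def ghj : ℕ → ℕ → ℝ → ℂ
  | 1, 6 => gh16
  | 2, 6 => gh26
  | 3, 6 => gh36
  | 1, 7 => gh17
  | 2, 7 => gh27
  | 3, 7 => gh37
  | _, _ => fun _ => 0

/-- `Z22:(8.13)–(8.18)` bridge. The bridge is definitional: `ffj 1 6 = ff16`, …. [cite: Zhang2022LandauSiegel, §8 (8.13)–(8.18) p.48] -/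
theorem ffj_eq : ffj 1 6 = ff16 ∧ ffj 2 6 = ff26 ∧ ffj 3 6 = ff36 ∧
    ffj 1 7 = ff17 ∧ ffj 2 7 = ff27 ∧ ffj 3 7 = ff37 := ⟨rfl, rfl, rfl, rfl, rfl, rfl⟩

/-- `Z22:(8.13)–(8.18)` bridge. The bridge is definitional: `ghj 1 6 = gh16`, …. [cite: Zhang2022LandauSiegel, §8 (8.13)–(8.18) p.48] -/
theorem ghj_eq : ghj 1 6 = gh16 ∧ ghj 2 6 = gh26 ∧ ghj 3 6 = gh36 ∧
    ghj 1 7 = gh17 ∧ ghj 2 7 = gh27 ∧ ghj 3 7 = gh37 := ⟨rfl, rfl, rfl, rfl, rfl, rfl⟩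

/-- `Z22:§12.u045` (p. 72, display after (12.15), tex L3668): "`e*_{1j} = ∫₀^{0.496}(ῑ₃𝔣𝔣_{j6}(0.498−z)/0.498
+ ῑ₄𝔣𝔣_{j7}(0.5−z)/0.5)dz`" — the tree's `estar1` (`Section18Defs`) at `(𝔣𝔣_{j6}, 𝔣𝔣_{j7})`, as a
`j`-indexed family (`estar1j 1 = estar11` etc. by `rfl`). [cite: Zhang2022LandauSiegel, §12 (12.15) p.72] -/
def estar1j (j : ℕ) : ℂ := estar1 (ffj j 6) (ffj j 7)

/-- `Z22:§12.u045` bridge. `e*₁₁, e*₁₂, e*₁₃` of the tree are `estar1j 1, 2, 3`. [cite: Zhang2022LandauSiegel, §12 (12.15) p.72] -/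
theorem estar1j_eq : estar1j 1 = estar11 ∧ estar1j 2 = estar12 ∧ estar1j 3 = estar13 := ⟨rfl, rfl, rfl⟩

/-- `Z22:§12.u045`, the printed integral, unfolded: `e*_{1j} = ∫₀^{0.496}(ῑ₃𝔣𝔣_{j6}(0.498−z)/0.498 +
ῑ₄𝔣𝔣_{j7}(0.5−z)/0.5)dz`. [cite: Zhang2022LandauSiegel, §12 (12.15) p.72] -/
theorem estar1j_def (j : ℕ) : estar1j j =
    ∫ z in (0:ℝ)..0.496, (conj iota3 * ffj j 6 (0.498 - z) / 0.498 + conj iota4 * ffj j 7 (0.5 - z) / 0.5) :=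
  rfl

/-- `Z22:§12.u044` (p. 72, tex L3664): "`e₁* = −πb*(3e*₁₁ + 6e*₁₂ + 3e*₁₃)`" — the tree's `e1star`
(`Section18Defs`), here in the `j`-indexed reading. [cite: Zhang2022LandauSiegel, §12 (12.15) p.72] -/
theorem e1star_eq_estar1j :
    e1star = -π * bstar * (3 * estar1j 1 + 6 * estar1j 2 + 3 * estar1j 3) := rfl

/-- `Z22:§12.u046` (p. 72, tex L3672): "`e₂* = (4/(0.504π))(−0.002ῑ₃/0.498 − 0.008ῑ₄ − 2πiῑ₄/250²)`" —
the tree's `e2star` (`Section18Defs`). [cite: Zhang2022LandauSiegel, §12 (12.15) p.72] -/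
theorem e2star_eq_bracket : e2star = ((4 / (0.504 * π) : ℝ) : ℂ) *
    (-0.002 * conj iota3 / 0.498 - 0.008 * conj iota4 - 2 * π * I * conj iota4 / 250 ^ 2) := rfl

/-! ## Restricted arithmetic sums and window sums -/

section Objects

variable (c' : ℝ) {D : ℕ} [NeZero D] (χ : DirichletCharacter ℂ D)

omit [NeZero D] in
open scoped Classical in
/-- `Z22:(12.12)` object (the split of `S_j`). `S_j(𝐚₁,𝐚₂)` of Proposition 7.1 (the skeleton's `Sj`, same summand verbatim) RESTRICTED to the pairs
`(d, r)` with `R(dr)` — "The sum is split into three sums according to `dr ≤ P″₁/T`, `P″₁/T < dr ≤ P″₁`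
and `P″₁ < dr < P₂`" (p. 71, tex L3605). [cite: Zhang2022LandauSiegel, §12 (12.12) p.71] -/
def SjOn (D : ℕ) (j : ℕ) (a₁ a₂ : ℕ → ℂ) (R : ℕ → Prop) : ℂ :=
  ∑ d ∈ Finset.Ico 1 (Nsupp D), ∑ r ∈ Finset.Ico 1 (Nsupp D), if R (d * r) then
    ((ArithmeticFunction.moebius r).natAbs : ℂ) * lamZero c' D j (d * r) /
        ((d * r : ℕ) * (Nat.totient r : ℂ)) *
      (∑ m ∈ Finset.Ico 1 (Nsupp D), a₁ (d * r * m) / (m : ℂ) ^ (1 - betaJ c' D j)) *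
      (∑ n ∈ Finset.Ico 1 (Nsupp D), a₂ (d * r * n) * xiZero c' D j n d r / (n : ℂ)) else 0

omit [NeZero D] in
/-- `Z22:(12.12)` bookkeeping (PROVED). Splitting `S_j` along a range and its complement is exact (bookkeeping for the "split into three /
two sums" sentences, pp. 71, 73). [cite: Zhang2022LandauSiegel, §12 (12.12) p.71] -/
theorem SjOn_add_SjOn_not (j : ℕ) (a₁ a₂ : ℕ → ℂ) (R : ℕ → Prop) :
    SjOn c' D j a₁ a₂ R + SjOn c' D j a₁ a₂ (fun k => ¬ R k) = Sj c' D j a₁ a₂ := by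
  classical
  unfold SjOn Sj
  rw [← Finset.sum_add_distrib]
  refine Finset.sum_congr rfl fun d _ => ?_
  rw [← Finset.sum_add_distrib]
  refine Finset.sum_congr rfl fun r _ => ?_
  by_cases h : R (d * r) <;> simp [h]

omit [NeZero D] in
/-- `Z22:(12.12)` bookkeeping (PROVED). `S_j` restricted to the always-true range is `S_j`. [cite: Zhang2022LandauSiegel, §7 Prop. 7.1 p.33] -/
theorem SjOn_true (j : ℕ) (a₁ a₂ : ℕ → ℂ) :
    SjOn c' D j a₁ a₂ (fun _ => True) = Sj c' D j a₁ a₂ := by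
  classical
  unfold SjOn Sj
  simp only [if_true]

omit [NeZero D] in
/-- `Z22:(12.12)` object. The range `dr ≤ P″₁/T` (p. 71). [cite: Zhang2022LandauSiegel, §12 (12.12) p.71] -/
def rngLow (D : ℕ) (k : ℕ) : Prop := (k : ℝ) ≤ P1pp D / bigT D

omit [NeZero D] in
/-- `Z22:(12.12)` object. The range `P″₁/T < dr ≤ P″₁` (p. 71). [cite: Zhang2022LandauSiegel, §12 (12.12) p.71] -/
def rngMid (D : ℕ) (k : ℕ) : Prop := P1pp D / bigT D < k ∧ (k : ℝ) ≤ P1pp D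

omit [NeZero D] in
/-- `Z22:(12.13)` object. The range `P″₁ < dr < P₂` (p. 71). [cite: Zhang2022LandauSiegel, §12 (12.13) p.71] -/
def rngTop (D : ℕ) (k : ℕ) : Prop := P1pp D < k ∧ (k : ℝ) < Skeleton.P2 D

omit [NeZero D] in
/-- `Z22:§12.u048` object. The range `dr ≤ P″₁` of the `Θ₁(𝐚₁₅,𝐚₂₂)` split (p. 73, tex L3688). [cite: Zhang2022LandauSiegel, §12 (12.16) p.73] -/
def rngBot (D : ℕ) (k : ℕ) : Prop := (k : ℝ) ≤ P1pp D

/-- `Z22:(12.12)`/`Z22:(12.13)` object. The window sum `Σ_{lo<n<hi} |χ(n)|λ₀ⱼ(n)φ(n)⁻¹·w(n)` into which `Σ_{dr=n}|μ(r)χ(dr)|λ₀ⱼ(dr)Π(d,r)/(drφ(r))`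
collapses by (8.10) (p. 47); `n` runs over `1 ≤ n < ⌈hi⌉` with `lo < n` (for "`n < P^{0.496}`" take `lo = 0`).
[cite: Zhang2022LandauSiegel, §8 (8.10) p.47] -/
def winSum (j : ℕ) (lo hi : ℝ) (w : ℕ → ℂ) : ℂ :=
  ∑ n ∈ (Finset.Ico 1 ⌈hi⌉₊).filter (fun n : ℕ => lo < (n : ℝ)),
    (‖χ (n : ZMod D)‖ : ℂ) * lamZero c' D j n / (Nat.totient n : ℂ) * w n

/-- `Z22:(12.13)`/`Z22:§12.u049` object. The same window sum with absolute values, `Σ_{lo<n<hi} |χ(n)||λ₀ⱼ(n)|φ(n)⁻¹·w(n)` (`w ≥ 0`), the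
carrier of the `ε_{1j}/ε_{2j}`-slacks. [cite: Zhang2022LandauSiegel, §8 (8.10) p.47] -/
def winAbs (j : ℕ) (lo hi : ℝ) (w : ℕ → ℝ) : ℝ :=
  ∑ n ∈ (Finset.Ico 1 ⌈hi⌉₊).filter (fun n : ℕ => lo < (n : ℝ)),
    ‖χ (n : ZMod D)‖ * ‖lamZero c' D j n‖ / (Nat.totient n : ℝ) * w n

/-! ## `𝓦_j`, `𝓦*_j` (pp. 71, 73) -/

omit [NeZero D] in
/-- `Z22:§12.u036`, explicit part: `𝓦⁰_j(y) = −1 + (−2β₆ + β_{j+1} + β_{j+2})log(y/P″₁)` (p. 71, tex L3624;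
the printed `𝓦_j` is `𝓦⁰_j + ε_{2j}`, see `frakw`). [cite: Zhang2022LandauSiegel, §12 (12.13) p.71] -/
def frakw0 (D : ℕ) (j : ℕ) (y : ℝ) : ℂ :=
  -1 + (-2 * beta6 D + betaJ c' D (j + 1) + betaJ c' D (j + 2)) * (Real.log (y / P1pp D) : ℂ)

omit [NeZero D] in
/-- `Z22:§12.u036` (p. 71, tex L3624): "`𝓦_j(n) = −1 + (−2β₆ + β_{j+1} + β_{j+2})log(n/P″₁) + ε_{2j}(n)`",
with the function `ε_{2j}(·)` of Lemma 12.3 (`|ε_{2j}| < 10⁻⁵`; defined by the manuscript only through that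
lemma, and written there as a function of the product `dr`) as an explicit argument `eps2`.
[cite: Zhang2022LandauSiegel, §12 (12.13) p.71] -/
def frakw (D : ℕ) (j : ℕ) (eps2 : ℝ → ℂ) (y : ℝ) : ℂ := frakw0 c' D j y + eps2 y

omit [NeZero D] in
/-- `Z22:§12.u050`, explicit part: `𝓦*⁰_j(y) = −1 + (2β₆ − β_j)log(y/P″₁)` (p. 73, tex L3704; printed
`𝓦*(n)`, the subscript `j` dropped). [cite: Zhang2022LandauSiegel, §12 (12.16) p.73] -/
def frakwStar0 (D : ℕ) (j : ℕ) (y : ℝ) : ℂ :=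
  -1 + (2 * beta6 D - betaJ c' D j) * (Real.log (y / P1pp D) : ℂ)

omit [NeZero D] in
/-- `Z22:§12.u050` (p. 73, tex L3704): "`𝓦*(n) = −1 + (2β₆ − β_j)log(n/P″₁) + ε_{1j}(n)`" [sic: `𝓦*_j`],
with the `ε_{1j}(·)` of Lemma 12.1 (`|ε_{1j}| < 10⁻⁵`) as an explicit argument `eps1`.
[cite: Zhang2022LandauSiegel, §12 (12.16) p.73] -/
def frakwStar (D : ℕ) (j : ℕ) (eps1 : ℝ → ℂ) (y : ℝ) : ℂ := frakwStar0 c' D j y + eps1 y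

/-! ## `Θ₁(𝐚₁₂,𝐚₂₅)`: the expansion of `S_j`, (12.12), (12.13), (12.14), (12.15) -/

/-- `Z22:§12.u035`, right side (p. 71, tex L3600): "`S_j(𝐚₁₂,𝐚₂₅) = Σ_rΣ_d |χ(d)||μχ(r)|λ₀ⱼ(dr)/(drφ(r))
(Σ_m χ(m)(ῑ₃ϰ₃(drm) + ῑ₄ϰ₂(drm))m^{−(1−β_j)}) × (Σ_n χ(n)ϰ̄₁₃(n)ξ₀ⱼ(n;d,r)/n)`", typed with `ϰ̄₁₃(drn)`
(the printed `ϰ̄₁₃(n)` is a slip: `a₂₅(drn) = χ(drn)ϰ̄₁₃(drn)`, and Lemma 12.3 evaluates `Σ_l χ(l)ϰ̄₁₃(drl)ξ_j(l;d,r)/l`);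
all sums truncated at `⌈PT⁻²⌉` as in `Skeleton.Sj`. [cite: Zhang2022LandauSiegel, §12 (12.12) p.71] -/
def sj1225rhs (j : ℕ) : ℂ :=
  ∑ d ∈ Finset.Ico 1 (Nsupp D), ∑ r ∈ Finset.Ico 1 (Nsupp D),
    (‖χ (d : ZMod D)‖ : ℂ) * (((ArithmeticFunction.moebius r).natAbs : ℂ) * ‖χ (r : ZMod D)‖) *
        lamZero c' D j (d * r) / ((d * r : ℕ) * (Nat.totient r : ℂ)) *
      (∑ m ∈ Finset.Ico 1 (Nsupp D), χ (m : ZMod D) *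
          (conj iota3 * vk3 D (d * r * m) + conj iota4 * vk2 D (d * r * m)) /
            (m : ℂ) ^ (1 - betaJ c' D j)) *
      (∑ n ∈ Finset.Ico 1 (Nsupp D), χ (n : ZMod D) * conj (vk13 D (d * r * n)) *
          xiZero c' D j n d r / (n : ℂ))

/-- `Z22:§12.u035` (p. 71, tex L3600): "We have `S_j(𝐚₁₂,𝐚₂₅) = [sj1225rhs]`" for the sequences of (9.2) and
(12.9) (`χ` real: `χ(drm) = χ(d)χ(r)χ(m)`, `χ(d)² = |χ(d)|`); `𝐚₂₅` (L3-t4's object) enters as an argument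
bound to its printed definition `a₂₅(n) = conj(χ(n)ϰ₁₃(n))`. CLAIM (an identity).
[cite: Zhang2022LandauSiegel, §12 (12.12) p.71] -/
def Step12u035 : Prop :=
  ForAllLarge fun D _ χ => ∀ a25 : ℕ → ℂ, (∀ n, a25 n = conj (χ (n : ZMod D) * vk13 D n)) →
    ∀ j ∈ ({1, 2, 3} : Finset ℕ), Sj c' D j (a12 χ) a25 = sj1225rhs c' χ j

/-- `Z22:(12.12)` (sentence preceding it) CLAIM. The un-displayed claim preceding (12.12) (p. 71, tex L3605): "By lemma 8.2, 8.3 and 12.1, the sum over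
`P″₁/T < dr ≤ P″₁` contributes `o(α)`" (our note, not the manuscript's: the bound for the `ϰ̄₁₃ξ_j`-factor on
this range is (12.11) of Lemma 12.2). CLAIM. [cite: Zhang2022LandauSiegel, §12 (12.12) p.71] -/
def Mid1225 : Prop :=
  ∀ ε : ℝ, 0 < ε → ForAllLarge fun D _ χ => AssumptionA D χ →
    ∀ a25 : ℕ → ℂ, (∀ n, a25 n = conj (χ (n : ZMod D) * vk13 D n)) →
      ∀ j ∈ ({1, 2, 3} : Finset ℕ), ‖SjOn c' D j (a12 χ) a25 (rngMid D)‖ ≤ ε * alpha D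

/-- `Z22:(12.12)` object. (12.12), first main term (p. 71): `L′(1,χ)² b* β_{j+1}β_{j+2} Σ_{n<P^{0.496}} |χ(n)|λ₀ⱼ(n)φ(n)⁻¹
(ῑ₃𝓕_{j6}(P^{0.498}/n)/0.498 + ῑ₄𝓕_{j7}(P^{0.5}/n)/0.5)` (`𝓕_{jμ}` = `Skeleton.frakfW`, `b*` = tree `bstar`).
[cite: Zhang2022LandauSiegel, §12 (12.12) p.71] -/
def main1212sum (j : ℕ) : ℂ :=
  deriv χ.LFunction 1 ^ 2 * bstar * (betaJ c' D (j + 1) * betaJ c' D (j + 2)) *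
    winSum c' χ j 0 (bigP D ^ (0.496 : ℝ)) fun n =>
      conj iota3 * frakfW c' D j 6 (bigP D ^ (0.498 : ℝ) / n) / 0.498 +
        conj iota4 * frakfW c' D j 7 (bigP D ^ (0.5 : ℝ) / n) / 0.5

/-- `Z22:(12.12)` object. (12.12), second main term (p. 71): `𝔞 b* (log P) β_{j+1}β_{j+2} ∫₀^{0.496}(ῑ₃𝔣𝔣_{j6}(0.498−z)/0.498 +
ῑ₄𝔣𝔣_{j7}(0.5−z)/0.5)dz`; the integral is `e*_{1j}` (`estar1j`). [cite: Zhang2022LandauSiegel, §12 (12.12) p.71] -/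
def main1212int (j : ℕ) : ℂ :=
  frakA χ * bstar * Real.log (bigP D) * (betaJ c' D (j + 1) * betaJ c' D (j + 2)) * estar1j j

/-- `Z22:(12.12)` (p. 71, tex L3607): "the sum over `dr ≤ P″₁/T` is equal to
`L′(1,χ)²b*β_{j+1}β_{j+2}Σ_{n<P^{0.496}}|χ(n)|λ₀ⱼ(n)φ(n)⁻¹(ῑ₃𝓕_{j6}(P^{0.498}/n)/0.498 + ῑ₄𝓕_{j7}(P^{0.5}/n)/0.5) + o(α)
= 𝔞b*(log P)β_{j+1}β_{j+2}∫₀^{0.496}(ῑ₃𝔣𝔣_{j6}(0.498−z)/0.498 + ῑ₄𝔣𝔣_{j7}(0.5−z)/0.5)dz + o(α)`" (by Lemmas 8.2,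
8.3 and 12.2 (12.10)). Both equalities, as a conjunction. CLAIM. [cite: Zhang2022LandauSiegel, §12 (12.12) p.71] -/
def Eq1212 : Prop :=
  ∀ ε : ℝ, 0 < ε → ForAllLarge fun D _ χ => AssumptionA D χ →
    ∀ a25 : ℕ → ℂ, (∀ n, a25 n = conj (χ (n : ZMod D) * vk13 D n)) →
      ∀ j ∈ ({1, 2, 3} : Finset ℕ),
        ‖SjOn c' D j (a12 χ) a25 (rngLow D) - main1212sum c' χ j‖ ≤ ε * alpha D ∧
        ‖SjOn c' D j (a12 χ) a25 (rngLow D) - main1212int c' χ j‖ ≤ ε * alpha D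

/-- `Z22:(12.13)` object. (12.13), first main term on the explicit part `𝓦⁰_j` (p. 71):
`(L′(1,χ)²ῑ₃/((0.504)(0.498)log²P)) Σ_{P^{0.496}<n<P^{0.498}} |χ(n)|λ₀ⱼ(n)φ(n)⁻¹𝓕_{j6}(P^{0.498}/n)𝓦⁰_j(n)
+ (L′(1,χ)²ῑ₄/((0.504)(0.5)log²P)) Σ_{P^{0.496}<n<P^{0.5}} |χ(n)|λ₀ⱼ(n)φ(n)⁻¹𝓕_{j7}(P^{0.5}/n)𝓦⁰_j(n)`.
[cite: Zhang2022LandauSiegel, §12 (12.13) p.71] -/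
def main1213sum (j : ℕ) : ℂ :=
  deriv χ.LFunction 1 ^ 2 * conj iota3 / (0.504 * 0.498 * Real.log (bigP D) ^ 2) *
      winSum c' χ j (bigP D ^ (0.496 : ℝ)) (bigP D ^ (0.498 : ℝ)) (fun n =>
        frakfW c' D j 6 (bigP D ^ (0.498 : ℝ) / n) * frakw0 c' D j n) +
    deriv χ.LFunction 1 ^ 2 * conj iota4 / (0.504 * 0.5 * Real.log (bigP D) ^ 2) *
      winSum c' χ j (bigP D ^ (0.496 : ℝ)) (bigP D ^ (0.5 : ℝ)) (fun n =>
        frakfW c' D j 7 (bigP D ^ (0.5 : ℝ) / n) * frakw0 c' D j n)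

/-- `Z22:(12.13)` object. (12.13), the carrier of the `ε_{2j}`-part of the first main term (`𝓦_j = 𝓦⁰_j + ε_{2j}`, `|ε_{2j}| < 10⁻⁵`):
the same two window sums with absolute values and `𝓦` replaced by `1`. [cite: Zhang2022LandauSiegel, §12 (12.13) p.71] -/
def maj1213sum (j : ℕ) : ℝ :=
  ‖deriv χ.LFunction 1‖ ^ 2 * ‖iota3‖ / (0.504 * 0.498 * Real.log (bigP D) ^ 2) *
      winAbs c' χ j (bigP D ^ (0.496 : ℝ)) (bigP D ^ (0.498 : ℝ)) (fun n =>
        ‖frakfW c' D j 6 (bigP D ^ (0.498 : ℝ) / n)‖) +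
    ‖deriv χ.LFunction 1‖ ^ 2 * ‖iota4‖ / (0.504 * 0.5 * Real.log (bigP D) ^ 2) *
      winAbs c' χ j (bigP D ^ (0.496 : ℝ)) (bigP D ^ (0.5 : ℝ)) (fun n =>
        ‖frakfW c' D j 7 (bigP D ^ (0.5 : ℝ) / n)‖)

/-- `Z22:(12.13)` object. (12.13), second main term on `𝓦⁰_j` (p. 71): `(𝔞ῑ₃/((0.504)(0.498)log P))∫_{0.496}^{0.498}𝔣𝔣_{j6}(0.498−z)𝓦⁰_j(P^z)dz
+ (𝔞ῑ₄/((0.504)(0.5)log P))∫_{0.496}^{0.5}𝔣𝔣_{j7}(0.5−z)𝓦⁰_j(P^z)dz`. [cite: Zhang2022LandauSiegel, §12 (12.13) p.71] -/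
def main1213int (j : ℕ) : ℂ :=
  frakA χ * conj iota3 / (0.504 * 0.498 * Real.log (bigP D)) *
      (∫ z in (0.496:ℝ)..0.498, ffj j 6 (0.498 - z) * frakw0 c' D j (bigP D ^ z)) +
    frakA χ * conj iota4 / (0.504 * 0.5 * Real.log (bigP D)) *
      (∫ z in (0.496:ℝ)..0.5, ffj j 7 (0.5 - z) * frakw0 c' D j (bigP D ^ z))

/-- `Z22:(12.13)` object. (12.13), the carrier of the `ε_{2j}`-part of the second main term. [cite: Zhang2022LandauSiegel, §12 (12.13) p.71] -/
def maj1213int (j : ℕ) : ℝ :=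
  frakA χ * ‖iota3‖ / (0.504 * 0.498 * Real.log (bigP D)) *
      (∫ z in (0.496:ℝ)..0.498, ‖ffj j 6 (0.498 - z)‖) +
    frakA χ * ‖iota4‖ / (0.504 * 0.5 * Real.log (bigP D)) *
      (∫ z in (0.496:ℝ)..0.5, ‖ffj j 7 (0.5 - z)‖)

/-- `Z22:(12.13)` (p. 71, tex L3614): "By lemma 8.2, 8.3 and 12.3, the sum over `P″₁ < dr < P₂` is equal to
`(L′²ῑ₃/((0.504)(0.498)log²P))Σ_{P^{0.496}<n<P^{0.498}}|χ(n)|λ₀ⱼ(n)φ(n)⁻¹𝓕_{j6}(P^{0.498}/n)𝓦_j(n)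
+ (L′²ῑ₄/((0.504)(0.5)log²P))Σ_{P^{0.496}<n<P^{0.5}}|χ(n)|λ₀ⱼ(n)φ(n)⁻¹𝓕_{j7}(P^{0.5}/n)𝓦_j(n) + o(α)
= (𝔞ῑ₃/((0.504)(0.498)log P))∫_{0.496}^{0.498}𝔣𝔣_{j6}(0.498−z)𝓦_j(P^z)dz + (𝔞ῑ₄/((0.504)(0.5)log P))∫_{0.496}^{0.5}
𝔣𝔣_{j7}(0.5−z)𝓦_j(P^z)dz + o(α)`", with `𝓦_j = 𝓦⁰_j + ε_{2j}`, `|ε_{2j}| < 10⁻⁵` (Lemma 12.3): typed on `𝓦⁰_j`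
with the `ε_{2j}`-part as the slack `10⁻⁵·maj` (both equalities, as a conjunction). CLAIM.
[cite: Zhang2022LandauSiegel, §12 (12.13) p.71] -/
def Eq1213 : Prop :=
  ∀ ε : ℝ, 0 < ε → ForAllLarge fun D _ χ => AssumptionA D χ →
    ∀ a25 : ℕ → ℂ, (∀ n, a25 n = conj (χ (n : ZMod D) * vk13 D n)) →
      ∀ j ∈ ({1, 2, 3} : Finset ℕ),
        ‖SjOn c' D j (a12 χ) a25 (rngTop D) - main1213sum c' χ j‖ ≤
            1e-5 * maj1213sum c' χ j + ε * alpha D ∧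
        ‖SjOn c' D j (a12 χ) a25 (rngTop D) - main1213int c' χ j‖ ≤
            1e-5 * maj1213int χ j + ε * alpha D

omit [NeZero D] in
/-- `Z22:§12.u037`, object (p. 71, tex L3628): the linear approximant `1 + πi(3−j)z` of `𝔣𝔣_{j6}(z)` on
`0 ≤ z ≤ 0.002`. [cite: Zhang2022LandauSiegel, §12 (12.13) p.71] -/
def apprF6 (j : ℕ) (z : ℝ) : ℂ := 1 + π * I * (3 - j) * z

omit [NeZero D] in
/-- `Z22:§12.u040`, object (p. 72, tex L3640): the linear approximant `1 + πi(5−j)z` of `𝔣𝔣_{j7}(z)` on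
`0 ≤ z ≤ 0.004`. [cite: Zhang2022LandauSiegel, §12 (12.14) p.72] -/
def apprF7 (j : ℕ) (z : ℝ) : ℂ := 1 + π * I * (5 - j) * z

/-- `Z22:§12.u037` (p. 71, tex L3628): "For `0 ≤ z ≤ 0.002`, a good approximation to `𝔣𝔣_{j6}(z)` is
`1 + πi(3−j)z ≃ 1 + (2β₆ − β_j)(log P)z`." Typed as its two precise contents: (i) `1 + πi(3−j)z` is the
tangent line of `𝔣𝔣_{j6}` at `0` (value `1`, derivative `πi(3−j)`, from (8.13)–(8.15)); (ii) the "`≃`":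
`(2β₆ − β_j)log P → πi(3−j)` as `D → ∞` ((2.13), (2.22): `2β₆log P = 3πi`, `β_j log P = jπi(1 + O(c′α𝓛))`).
CLAIM. [cite: Zhang2022LandauSiegel, §12 (12.13) p.71] -/
def Step12u037 : Prop :=
  (∀ j ∈ ({1, 2, 3} : Finset ℕ), ffj j 6 0 = 1 ∧ HasDerivAt (ffj j 6) (π * I * (3 - j)) 0) ∧
  ∀ ε : ℝ, 0 < ε → ForAllLarge fun D _ _ => ∀ j ∈ ({1, 2, 3} : Finset ℕ),
    ‖(2 * beta6 D - betaJ c' D j) * Real.log (bigP D) - π * I * (3 - j)‖ ≤ ε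

/-- `Z22:§12.u038` (p. 72, tex L3632): "Since `4β₆ − β₁ − β₂ − β₃ ≃ 0`" — at the scale at which it is used
(multiplied by `log P`, inside `𝓦_j(P^z)`): `(4β₆ − β₁ − β₂ − β₃)log P → 0` (exactly `6c′πiα𝓛 → 0` by (2.13),
(2.22)). CLAIM. [cite: Zhang2022LandauSiegel, §12 (12.14) p.72] -/
def Step12u038 : Prop :=
  ∀ ε : ℝ, 0 < ε → ForAllLarge fun D _ _ =>
    ‖(4 * beta6 D - beta1 c' D - beta2 c' D - beta3 c' D) * Real.log (bigP D)‖ ≤ ε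

/-- `Z22:§12.u039` (p. 72, tex L3636; NUM:N-07): "it follows by simple calculation that
`∫_{0.496}^{0.498} 𝔣𝔣_{j6}(0.498−z)𝓦_j(P^z)dz = −0.002 + ε/10`", `ε` the manuscript's generic quantity of modulus
`< 10⁻⁵`. With `𝓦_j = 𝓦⁰_j + ε_{2j}`, `|ε_{2j}| < 10⁻⁵`, the checkable content is the enclosure of the explicit
integral: `|∫𝔣𝔣_{j6}(0.498−z)𝓦⁰_j(P^z)dz + 0.002| ≤ 10⁻⁶ + 10⁻⁵∫_{0.496}^{0.498}|𝔣𝔣_{j6}(0.498−z)|dz` for all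
large `D` (the `β`'s of `𝓦⁰_j` depend on `D`; `log(P^z/P″₁) = (z − 0.496)log P − log(Dt₀)`). NUMERICAL CLAIM
(read1's prior: false pointwise by a factor 30–65 — not adjudicated here). [cite: Zhang2022LandauSiegel, §12 (12.14) p.72] -/
def Step12u039 : Prop :=
  ForAllLarge fun D _ _ => ∀ j ∈ ({1, 2, 3} : Finset ℕ),
    ‖(∫ z in (0.496:ℝ)..0.498, ffj j 6 (0.498 - z) * frakw0 c' D j (bigP D ^ z)) + 0.002‖ ≤
      1e-6 + 1e-5 * ∫ z in (0.496:ℝ)..0.498, ‖ffj j 6 (0.498 - z)‖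

/-- `Z22:§12.u040` (p. 72, tex L3640): "For `0 ≤ z ≤ 0.004`, a good approximation to `𝔣𝔣_{j7}(z)` is
`1 + πi(5−j)z ≃ 1 + (2β₇ − β_j)(log P)z`": (i) tangent line of `𝔣𝔣_{j7}` at `0` ((8.16)–(8.18)); (ii)
`(2β₇ − β_j)log P → πi(5−j)` (`2β₇log P = 5πi`). CLAIM. [cite: Zhang2022LandauSiegel, §12 (12.14) p.72] -/
def Step12u040 : Prop :=
  (∀ j ∈ ({1, 2, 3} : Finset ℕ), ffj j 7 0 = 1 ∧ HasDerivAt (ffj j 7) (π * I * (5 - j)) 0) ∧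
  ∀ ε : ℝ, 0 < ε → ForAllLarge fun D _ _ => ∀ j ∈ ({1, 2, 3} : Finset ℕ),
    ‖(2 * beta7 D - betaJ c' D j) * Real.log (bigP D) - π * I * (5 - j)‖ ≤ ε

omit [NeZero D] in
/-- `Z22:§12.u041` (p. 72, tex L3644): "for `0.496 ≤ z ≤ 0.5`, the function `𝔣𝔣_{j7}(0.5−z)𝓦_j(P^z)` can be
well approximated by `−1 − (2β₇ − β_j)(log P)(0.5 − z) − (2β₆ − β_{j+1} − β_{j+2})(log P)(z − 0.496)`" — the
approximant, as an object (the product of the two tangent lines with the quadratic term and `log(Dt₀)/log P`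
dropped; its use is u043). [cite: Zhang2022LandauSiegel, §12 (12.14) p.72] -/
def apprFW7 (D : ℕ) (j : ℕ) (z : ℝ) : ℂ :=
  -1 - (2 * beta7 D - betaJ c' D j) * Real.log (bigP D) * ((0.5 - z : ℝ) : ℂ) -
    (2 * beta6 D - betaJ c' D (j + 1) - betaJ c' D (j + 2)) * Real.log (bigP D) * ((z - 0.496 : ℝ) : ℂ)

/-- `Z22:§12.u042` (p. 72, tex L3648): "Since `(2β₆ + 2β₇ − β₁ − β₂ − β₃)log P ≃ 2πi`" — the limit
`(3 + 5 − 6)πi = 2πi` ((2.13), (2.22)). CLAIM. [cite: Zhang2022LandauSiegel, §12 (12.14) p.72] -/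
def Step12u042 : Prop :=
  ∀ ε : ℝ, 0 < ε → ForAllLarge fun D _ _ =>
    ‖(2 * beta6 D + 2 * beta7 D - beta1 c' D - beta2 c' D - beta3 c' D) * Real.log (bigP D) -
        2 * π * I‖ ≤ ε

/-- `Z22:§12.u043` (p. 72, tex L3652; NUM:N-07): "it follows that
`∫_{0.496}^{0.5} 𝔣𝔣_{j6}(0.5−z)𝓦_j(P^z)dz = −0.004 − πi/250² + ε/10`" [sic: `𝔣𝔣_{j7}(0.5−z)`, the function approximated
in the preceding sentence and the integrand of (12.13); typed with `𝔣𝔣_{j7}`]. As for u039, on the explicit part: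
`|∫𝔣𝔣_{j7}(0.5−z)𝓦⁰_j(P^z)dz + 0.004 + πi/250²| ≤ 10⁻⁶ + 10⁻⁵∫_{0.496}^{0.5}|𝔣𝔣_{j7}(0.5−z)|dz` for all large `D`.
NUMERICAL CLAIM. [cite: Zhang2022LandauSiegel, §12 (12.14) p.72] -/
def Step12u043 : Prop :=
  ForAllLarge fun D _ _ => ∀ j ∈ ({1, 2, 3} : Finset ℕ),
    ‖(∫ z in (0.496:ℝ)..0.5, ffj j 7 (0.5 - z) * frakw0 c' D j (bigP D ^ z)) + 0.004 +
        π * I / 250 ^ 2‖ ≤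
      1e-6 + 1e-5 * ∫ z in (0.496:ℝ)..0.5, ‖ffj j 7 (0.5 - z)‖

/-- `Z22:(12.14)` object. (12.14), main term (p. 72): `𝔞/(0.504 log P) · (−0.002ῑ₃/0.498 − 0.008ῑ₄ − 2πiῑ₄/250²)` (the bracket is
`(0.504π/4)e₂*`, so this equals `𝔞αe₂*/4`). [cite: Zhang2022LandauSiegel, §12 (12.14) p.72] -/
def main1214 : ℂ :=
  frakA χ / (0.504 * Real.log (bigP D)) *
    (-0.002 * conj iota3 / 0.498 - 0.008 * conj iota4 - 2 * π * I * conj iota4 / 250 ^ 2)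

/-- `Z22:(12.14)` (p. 72, tex L3656; NUM:N-08 for the constant): "inserting these results into (12.13), we
find that the sum over `P″₁ < dr < P₂` is equal to `𝔞/(0.504 log P)(−0.002ῑ₃/0.498 − 0.008ῑ₄ − 2πiῑ₄/250² + ε/4)`"
— "`ε/4`" typed as a slack of modulus `≤ 10⁻⁵/4` times the prefactor `𝔞/(0.504 log P)`, plus the `o(α)` of
(12.13). CLAIM. [cite: Zhang2022LandauSiegel, §12 (12.14) p.72] -/
def Eq1214 : Prop :=
  ∀ ε : ℝ, 0 < ε → ForAllLarge fun D _ χ => AssumptionA D χ →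
    ∀ a25 : ℕ → ℂ, (∀ n, a25 n = conj (χ (n : ZMod D) * vk13 D n)) →
      ∀ j ∈ ({1, 2, 3} : Finset ℕ),
        ‖SjOn c' D j (a12 χ) a25 (rngTop D) - main1214 χ‖ ≤
          frakA χ / (0.504 * Real.log (bigP D)) * (1e-5 / 4) + ε * alpha D

/-- `Z22:(12.15)` (p. 72, tex L3660; NUM:N-08): "It follows from (12.12) and (12.14) that
`(1/2α)S₁(𝐚₁₂,𝐚₂₅) + (2/α)S₂(𝐚₁₂,𝐚₂₅) + (3/2α)S₃(𝐚₁₂,𝐚₂₅) = 𝔞(e₁* + e₂* + ε/2)`" (`e₁*, e₂*` = tree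
`e1star, e2star`; "`ε/2`" a slack `≤ 10⁻⁵𝔞/2`; the `o(1)` coming from the `o(α)` terms is suppressed in print
and restored here). CLAIM. [cite: Zhang2022LandauSiegel, §12 (12.15) p.72] -/
def Eq1215 : Prop :=
  ∀ ε : ℝ, 0 < ε → ForAllLarge fun D _ χ => AssumptionA D χ →
    ∀ a25 : ℕ → ℂ, (∀ n, a25 n = conj (χ (n : ZMod D) * vk13 D n)) →
      ‖(1 / (2 * alpha D) * Sj c' D 1 (a12 χ) a25 + 2 / alpha D * Sj c' D 2 (a12 χ) a25 +
            3 / (2 * alpha D) * Sj c' D 3 (a12 χ) a25 : ℂ) - frakA χ * (e1star + e2star)‖ ≤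
        frakA χ * (1e-5 / 2) + ε

/-! ## `Θ₁(𝐚₁₅,𝐚₂₂)`: the expansion of `S_j`, the p. 73 evaluations, (12.16) -/

/-- `Z22:§12.u047`, right side (p. 73, tex L3683): "`S_j(𝐚₁₅,𝐚₂₂) = Σ_rΣ_d |χ(d)||μχ(r)|λ₀ⱼ(dr)/(drφ(r))
(Σ_m χ(m)ϰ₁₃(m)m^{−(1−β_j)}) × (Σ_n χ(n)(ι₃ϰ̄₃(drn) + ι₄ϰ̄₂(drn))ξ₀ⱼ(n;d,r)/n)`", typed with `ϰ₁₃(drm)` (the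
printed `ϰ₁₃(m)` is a slip: `a₁₅(drm) = χ(drm)ϰ₁₃(drm)`; Lemma 12.1 evaluates `Σ_l χ(l)ϰ₁₃(dl)l^{β_j−1}`).
[cite: Zhang2022LandauSiegel, §12 (12.16) p.73] -/
def sj1522rhs (j : ℕ) : ℂ :=
  ∑ d ∈ Finset.Ico 1 (Nsupp D), ∑ r ∈ Finset.Ico 1 (Nsupp D),
    (‖χ (d : ZMod D)‖ : ℂ) * (((ArithmeticFunction.moebius r).natAbs : ℂ) * ‖χ (r : ZMod D)‖) *
        lamZero c' D j (d * r) / ((d * r : ℕ) * (Nat.totient r : ℂ)) *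
      (∑ m ∈ Finset.Ico 1 (Nsupp D), χ (m : ZMod D) * vk13 D (d * r * m) /
          (m : ℂ) ^ (1 - betaJ c' D j)) *
      (∑ n ∈ Finset.Ico 1 (Nsupp D), χ (n : ZMod D) *
          (iota3 * conj (vk3 D (d * r * n)) + iota4 * conj (vk2 D (d * r * n))) *
            xiZero c' D j n d r / (n : ℂ))

/-- `Z22:§12.u047` (p. 73, tex L3683): "We have `S_j(𝐚₁₅,𝐚₂₂) = [sj1522rhs]`"; `𝐚₁₅` (L3-t4's object) enters as
an argument bound to `a₁₅(n) = χ(n)ϰ₁₃(n)`, `𝐚₂₂ = conj 𝐚₁₂` is `Skeleton.a22`. CLAIM (an identity).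
[cite: Zhang2022LandauSiegel, §12 (12.16) p.73] -/
def Step12u047 : Prop :=
  ForAllLarge fun D _ χ => ∀ a15 : ℕ → ℂ, (∀ n, a15 n = χ (n : ZMod D) * vk13 D n) →
    ∀ j ∈ ({1, 2, 3} : Finset ℕ), Sj c' D j a15 (a22 χ) = sj1522rhs c' χ j

/-- `Z22:§12.u048` (sentence preceding it) CLAIM. The un-displayed claim of p. 73 (tex L3688): "The sum is split into two sums according to `dr ≤ P″₁` and
`P″₁ < dr < P₂`. By lemma 8.2, 8.3 and 12.1, the first sum contributes `o(α)`". CLAIM.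
[cite: Zhang2022LandauSiegel, §12 (12.16) p.73] -/
def Low1522 : Prop :=
  ∀ ε : ℝ, 0 < ε → ForAllLarge fun D _ χ => AssumptionA D χ →
    ∀ a15 : ℕ → ℂ, (∀ n, a15 n = χ (n : ZMod D) * vk13 D n) →
      ∀ j ∈ ({1, 2, 3} : Finset ℕ), ‖SjOn c' D j a15 (a22 χ) (rngBot D)‖ ≤ ε * alpha D

/-- `Z22:§12.u048` (p. 73, tex L3690), VERBATIM: "…; the second sum [over `P″₁ < dr < P₂`] is equal to
`𝔞b*∫₀^{0.496}(ῑ₃𝔣𝔣_{j6}(0.498−z) + ῑ₄𝔣𝔣_{j6}(0.5−z))dz + o(α)`." CAVEAT (recorded, not resolved): the next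
sentence evaluates the same sum differently (u049), (12.16) carries no `b*`-term, and the main term here is of
size `𝔞b*`, not `O(𝔞α)` — an editing remnant of (12.12) on our reading; typed as printed for the record,
GAP-LEDGER candidate; no node below depends on it. CLAIM AS PRINTED. [cite: Zhang2022LandauSiegel, §12 (12.16) p.73] -/
def Step12u048 : Prop :=
  ∀ ε : ℝ, 0 < ε → ForAllLarge fun D _ χ => AssumptionA D χ →
    ∀ a15 : ℕ → ℂ, (∀ n, a15 n = χ (n : ZMod D) * vk13 D n) →
      ∀ j ∈ ({1, 2, 3} : Finset ℕ),
        ‖SjOn c' D j a15 (a22 χ) (rngTop D) -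
            frakA χ * bstar *
              ∫ z in (0:ℝ)..0.496, (conj iota3 * ffj j 6 (0.498 - z) + conj iota4 * ffj j 6 (0.5 - z))‖ ≤
          ε * alpha D

/-- `Z22:§12.u049` object. first main term on the explicit part `𝓦*⁰_j` (p. 73):
`(L′²ι₃/((0.504)(0.498)log²P))Σ_{P^{0.496}<n<P^{0.498}}|χ(n)|λ₀ⱼ(n)φ(n)⁻¹𝓖_{j6}(P^{0.498}/n)𝓦*⁰_j(n)
+ (L′²ι₄/((0.504)(0.5)log²P))Σ_{P^{0.496}<n<P^{0.5}}|χ(n)|λ₀ⱼ(n)φ(n)⁻¹𝓖_{j7}(P^{0.5}/n)𝓦*⁰_j(n)` (`𝓖_{jμ}` =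
`Skeleton.frakgW`). [cite: Zhang2022LandauSiegel, §12 (12.16) p.73] -/
def main12u049sum (j : ℕ) : ℂ :=
  deriv χ.LFunction 1 ^ 2 * iota3 / (0.504 * 0.498 * Real.log (bigP D) ^ 2) *
      winSum c' χ j (bigP D ^ (0.496 : ℝ)) (bigP D ^ (0.498 : ℝ)) (fun n =>
        frakgW c' D j 6 (bigP D ^ (0.498 : ℝ) / n) * frakwStar0 c' D j n) +
    deriv χ.LFunction 1 ^ 2 * iota4 / (0.504 * 0.5 * Real.log (bigP D) ^ 2) *
      winSum c' χ j (bigP D ^ (0.496 : ℝ)) (bigP D ^ (0.5 : ℝ)) (fun n =>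
        frakgW c' D j 7 (bigP D ^ (0.5 : ℝ) / n) * frakwStar0 c' D j n)

/-- `Z22:§12.u049` object. the carrier of the `ε_{1j}`-part of the first main term. [cite: Zhang2022LandauSiegel, §12 (12.16) p.73] -/
def maj12u049sum (j : ℕ) : ℝ :=
  ‖deriv χ.LFunction 1‖ ^ 2 * ‖iota3‖ / (0.504 * 0.498 * Real.log (bigP D) ^ 2) *
      winAbs c' χ j (bigP D ^ (0.496 : ℝ)) (bigP D ^ (0.498 : ℝ)) (fun n =>
        ‖frakgW c' D j 6 (bigP D ^ (0.498 : ℝ) / n)‖) +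
    ‖deriv χ.LFunction 1‖ ^ 2 * ‖iota4‖ / (0.504 * 0.5 * Real.log (bigP D) ^ 2) *
      winAbs c' χ j (bigP D ^ (0.496 : ℝ)) (bigP D ^ (0.5 : ℝ)) (fun n =>
        ‖frakgW c' D j 7 (bigP D ^ (0.5 : ℝ) / n)‖)

/-- `Z22:§12.u049` object. second main term on `𝓦*⁰_j` (p. 73): `(𝔞ι₃/((0.504)(0.498)log P))∫_{0.496}^{0.498}𝔤𝔥_{j6}(0.498−z)𝓦*⁰_j(P^z)dz
+ (𝔞ι₄/((0.504)(0.5)log P))∫_{0.496}^{0.5}𝔤𝔥_{j7}(0.5−z)𝓦*⁰_j(P^z)dz`. [cite: Zhang2022LandauSiegel, §12 (12.16) p.73] -/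
def main12u049int (j : ℕ) : ℂ :=
  frakA χ * iota3 / (0.504 * 0.498 * Real.log (bigP D)) *
      (∫ z in (0.496:ℝ)..0.498, ghj j 6 (0.498 - z) * frakwStar0 c' D j (bigP D ^ z)) +
    frakA χ * iota4 / (0.504 * 0.5 * Real.log (bigP D)) *
      (∫ z in (0.496:ℝ)..0.5, ghj j 7 (0.5 - z) * frakwStar0 c' D j (bigP D ^ z))

/-- `Z22:§12.u049` object. the carrier of the `ε_{1j}`-part of the second main term. [cite: Zhang2022LandauSiegel, §12 (12.16) p.73] -/
def maj12u049int (j : ℕ) : ℝ :=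
  frakA χ * ‖iota3‖ / (0.504 * 0.498 * Real.log (bigP D)) *
      (∫ z in (0.496:ℝ)..0.498, ‖ghj j 6 (0.498 - z)‖) +
    frakA χ * ‖iota4‖ / (0.504 * 0.5 * Real.log (bigP D)) *
      (∫ z in (0.496:ℝ)..0.5, ‖ghj j 7 (0.5 - z)‖)

/-- `Z22:§12.u049` (p. 73, tex L3694): "By lemma 8.2, 8.3 and 12.3 [our note: relative to (12.13) the roles of
the two factors are exchanged — Lemma 8.4 evaluates the `ξ₀ⱼ`-sum, Lemma 12.1 the `ϰ₁₃`-sum], the sum over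
`P″₁ < dr < P₂` is equal to `(L′²ι₃/((0.504)(0.498)log²P))Σ_{P^{0.496}<n<P^{0.498}}|χ(n)|λ₀ⱼ(n)φ(n)⁻¹𝓖_{j6}(P^{0.498}/n)𝓦*_j(n)
+ (L′²ι₄/((0.504)(0.5)log²P))Σ_{P^{0.496}<n<P^{0.5}}(…)𝓖_{j7}(P^{0.5}/n)𝓦*_j(n) + o(α)
= (𝔞ι₃/((0.504)(0.498)log P))∫_{0.496}^{0.498}𝔤𝔥_{j6}(0.498−z)𝓦*_j(P^z)dz + (𝔞ι₄/((0.504)(0.5)log P))∫_{0.496}^{0.5}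
𝔤𝔥_{j7}(0.5−z)𝓦*_j(P^z)dz + o(α)`", `𝓦*_j = 𝓦*⁰_j + ε_{1j}`, `|ε_{1j}| < 10⁻⁵` (Lemma 12.1): typed on `𝓦*⁰_j`
with the slack `10⁻⁵·maj` (both equalities). CLAIM. [cite: Zhang2022LandauSiegel, §12 (12.16) p.73] -/
def Step12u049 : Prop :=
  ∀ ε : ℝ, 0 < ε → ForAllLarge fun D _ χ => AssumptionA D χ →
    ∀ a15 : ℕ → ℂ, (∀ n, a15 n = χ (n : ZMod D) * vk13 D n) →
      ∀ j ∈ ({1, 2, 3} : Finset ℕ),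
        ‖SjOn c' D j a15 (a22 χ) (rngTop D) - main12u049sum c' χ j‖ ≤
            1e-5 * maj12u049sum c' χ j + ε * alpha D ∧
        ‖SjOn c' D j a15 (a22 χ) (rngTop D) - main12u049int c' χ j‖ ≤
            1e-5 * maj12u049int χ j + ε * alpha D

omit [NeZero D] in
/-- `Z22:§12.u051` object. The limit slopes `k₆ = 3/2`, `k₇ = 5/2` of `β_μ log P/(πi)` ((2.22)) and `j ↦ j mod 3 ∈ {1,2,3}` of
`β_j log P/(πi)` ((2.13), with `β₄ = β₁`, `β₅ = β₂`), used to spell the limits of u051.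
[cite: Zhang2022LandauSiegel, §2 (2.13), (2.22) p.9] -/
def slope (i : ℕ) : ℝ :=
  if i = 6 then 3 / 2 else if i = 7 then 5 / 2 else
    if i % 3 = 1 then 1 else if i % 3 = 2 then 2 else 3

omit [NeZero D] in
/-- `Z22:§12.u051`, object (p. 73, tex L3708): the linear approximant `1 − (2β_μ − β_{j+1} − β_{j+2})(log P)z`
of `𝔤𝔥_{jμ}(z)` on `0 ≤ z ≤ 0.004`. [cite: Zhang2022LandauSiegel, §12 (12.16) p.73] -/
def apprG (D : ℕ) (j μ : ℕ) (z : ℝ) : ℂ :=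
  1 - (2 * betaMu D μ - betaJ c' D (j + 1) - betaJ c' D (j + 2)) * Real.log (bigP D) * (z : ℂ)

/-- `Z22:§12.u051` (p. 73, tex L3708): "For `0 ≤ z ≤ 0.004` and `μ = 6,7`, the function `𝔤𝔥_{jμ}(z)` is
well-approximated by `1 − (2β_μ − β_{j+1} − β_{j+2})(log P)z`." Typed as: (i) `𝔤𝔥_{jμ}(0) = 1` and
`𝔤𝔥′_{jμ}(0) = −(2k_μ − k_{j+1} − k_{j+2})πi` (the tangent line, from (8.13)–(8.18)); (ii)
`(2β_μ − β_{j+1} − β_{j+2})log P → (2k_μ − k_{j+1} − k_{j+2})πi`. CLAIM. [cite: Zhang2022LandauSiegel, §12 (12.16) p.73] -/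
def Step12u051 : Prop :=
  (∀ j ∈ ({1, 2, 3} : Finset ℕ), ∀ μ ∈ ({6, 7} : Finset ℕ),
    ghj j μ 0 = 1 ∧
      HasDerivAt (ghj j μ) (-(2 * slope μ - slope (j + 1) - slope (j + 2)) * π * I) 0) ∧
  ∀ ε : ℝ, 0 < ε → ForAllLarge fun D _ _ => ∀ j ∈ ({1, 2, 3} : Finset ℕ), ∀ μ ∈ ({6, 7} : Finset ℕ),
    ‖(2 * betaMu D μ - betaJ c' D (j + 1) - betaJ c' D (j + 2)) * Real.log (bigP D) -
        (2 * slope μ - slope (j + 1) - slope (j + 2)) * π * I‖ ≤ ε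

/-- `Z22:(12.16)` (p. 73, tex L3710; NUM:N-08): "Thus, in a way similar to the evaluation of `Θ₁(𝐚₁₂,𝐚₂₅)`,
we deduce that `(1/2α)S₁(𝐚₁₅,𝐚₂₃) + (2/α)S₂(𝐚₁₅,𝐚₂₂) + (3/2α)S₃(𝐚₁₅,𝐚₂₂) = 𝔞(conj e₂* + ε/2)`" [sic:
`S₁(𝐚₁₅,𝐚₂₂)`; typed with `𝐚₂₂` throughout] ("`ε/2`" a slack `≤ 10⁻⁵𝔞/2`; the suppressed `o(1)` restored).
CLAIM. [cite: Zhang2022LandauSiegel, §12 (12.16) p.73] -/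
def Eq1216 : Prop :=
  ∀ ε : ℝ, 0 < ε → ForAllLarge fun D _ χ => AssumptionA D χ →
    ∀ a15 : ℕ → ℂ, (∀ n, a15 n = χ (n : ZMod D) * vk13 D n) →
      ‖(1 / (2 * alpha D) * Sj c' D 1 a15 (a22 χ) + 2 / alpha D * Sj c' D 2 a15 (a22 χ) +
            3 / (2 * alpha D) * Sj c' D 3 a15 (a22 χ) : ℂ) - frakA χ * conj e2star‖ ≤
        frakA χ * (1e-5 / 2) + ε

/-! ## (12.17): the final sentence of §12 as a finer deduction node -/

/-- `Z22:(12.17)`, its printed proof (p. 73, tex L3713): "Finally, by (12.9), (12.15) and (12.16) we conclude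
`Ξ₁₅ = (e₁* + 2e₂* + ε)𝔞𝔓` (12.17)" — the statement (12.17) is the banked node `Skeleton.Eval1217 c′`
(p409865; coarse deduction `Skeleton.Ded1217 c′`). The finer deduction named here: Proposition 7.1 (to pass
from `Θ₁` to `α⁻¹(½S₁ + 2S₂ + 3/2S₃)𝔓`), the (12.9)-shaped reduction `Ξ₁₅ = Θ₁(𝐚₁₂,𝐚₂₅) + conj Θ₁(𝐚₁₅,𝐚₂₂)
+ o(𝔓)` (L3-t4's node, taken here in its printed shape as a hypothesis), (12.15) and (12.16) ⇒ (12.17).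
CLAIM (a deduction). [cite: Zhang2022LandauSiegel, §12 (12.17) p.73] -/
def Ded1217fine : Prop :=
  Prop71 c' →
    (∀ ε : ℝ, 0 < ε → ForAllLarge fun D _ χ => AssumptionA D χ →
      ∀ a15 a25 : ℕ → ℂ, (∀ n, a15 n = χ (n : ZMod D) * vk13 D n) → (∀ n, a25 n = conj (a15 n)) →
        ‖xi15 c' χ - (Theta1 c' χ (a12 χ) a25 + conj (Theta1 c' χ a15 (a22 χ)))‖ ≤ ε * frakP D) →
    Eq1215 c' → Eq1216 c' → Eval1217 c'

end Objects

/-! ## Discharges (L3-t9, free nodes): the two `S_j` expansions u035/u047 are identities, the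
tangent/limit data u051 is exact algebra of (2.13), (2.22), (8.13)–(8.18), and the main term of (12.14)
is `𝔞αe₂*/4` -/

section Discharges

/-- `Z22:(8.13)–(8.18)` bookkeeping (PROVED): `𝔤𝔥(0) = r₀ + r₁` for the generic shape
`r₀ + (r₁ + bπiz)e^{−kπiz}`. [cite: Zhang2022LandauSiegel, §8 (8.13)–(8.18) p.48] -/
theorem ghF_apply_zero (r0 r1 b k : ℚ) : ghF r0 r1 b k 0 = r0 + r1 := by
  simp [ghF]

/-- `Z22:(8.13)–(8.18)` bookkeeping (PROVED): the derivative of `r₀ + (r₁ + bπiz)e^{−kπiz}` at `z = 0`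
is `(b − r₁k)πi`. [cite: Zhang2022LandauSiegel, §8 (8.13)–(8.18) p.48] -/
theorem hasDerivAt_ghF_zero (r0 r1 b k : ℚ) :
    HasDerivAt (ghF r0 r1 b k) (((b - r1 * k : ℚ) : ℂ) * π * I) 0 := by
  have h1 : HasDerivAt (fun w : ℂ => (r1 : ℂ) + (b : ℂ) * π * I * w) ((b : ℂ) * π * I) 0 := by
    simpa using ((hasDerivAt_id (0 : ℂ)).const_mul ((b : ℂ) * π * I)).const_add (r1 : ℂ)
  have h2 : HasDerivAt (fun w : ℂ => cexp (-((k : ℂ) * π * I * w))) (-((k : ℂ) * π * I)) 0 := by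
    simpa using (((hasDerivAt_id (0 : ℂ)).const_mul ((k : ℂ) * π * I)).neg).cexp
  have e : (b : ℂ) * π * I * cexp (-((k : ℂ) * π * I * 0)) +
        ((r1 : ℂ) + (b : ℂ) * π * I * 0) * (-((k : ℂ) * π * I))
      = ((b - r1 * k : ℚ) : ℂ) * π * I := by
    simp only [mul_zero, neg_zero, Complex.exp_zero, add_zero, mul_one]
    push_cast
    ring
  have h := ((h1.mul h2).congr_deriv e).const_add (r0 : ℂ)
  rw [← Complex.ofReal_zero] at h
  exact h.comp_ofReal

/-- `α log P = π` ((2.6), (2.10): `log P = 𝓛⁹`), for `𝓛 ≥ 1`. [cite: Zhang2022LandauSiegel, §2 (2.10) p.6] -/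
theorem alpha_mul_log_bigP (D : ℕ) (hL : 1 ≤ ell D) : alpha D * Real.log (bigP D) = π := by
  have h9 : ell D ^ 9 ≠ 0 := pow_ne_zero _ (by linarith)
  rw [alpha, bigP, Real.log_exp]
  field_simp

/-- `α𝓛 = π𝓛⁻⁸` ((2.6), (2.10)), for `𝓛 ≥ 1`. [cite: Zhang2022LandauSiegel, §2 (2.10) p.6] -/
theorem alpha_mul_ell (D : ℕ) (hL : 1 ≤ ell D) : alpha D * ell D = π / ell D ^ 8 := by
  have h0 : ell D ≠ 0 := by linarith
  rw [alpha, bigP, Real.log_exp]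
  field_simp

/-- For `D ≥ D₀(K, ε)`: `𝓛 ≥ 1` and `K𝓛⁻⁸ ≤ ε` — the common tail estimate of the limit nodes of
§12 (and of every "`≃`" of §§10–12). [cite: Zhang2022LandauSiegel, §2 (2.1) p.4] -/
theorem ell_large (K ε : ℝ) (hK : 0 ≤ K) (hε : 0 < ε) :
    ∃ D₀ : ℕ, ∀ D : ℕ, D₀ ≤ D → 1 ≤ ell D ∧ K / ell D ^ 8 ≤ ε := by
  refine ⟨⌈Real.exp (max 1 (K / ε))⌉₊, fun D hD => ?_⟩
  have hexp : Real.exp (max 1 (K / ε)) ≤ D := le_trans (Nat.le_ceil _) (by exact_mod_cast hD)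
  have hL : max 1 (K / ε) ≤ ell D := by
    rw [ell]
    exact (Real.le_log_iff_exp_le (lt_of_lt_of_le (Real.exp_pos _) hexp)).mpr hexp
  have h1 : 1 ≤ ell D := le_trans (le_max_left _ _) hL
  have h2 : K / ε ≤ ell D := le_trans (le_max_right _ _) hL
  have hLpos : 0 < ell D := by linarith
  refine ⟨h1, ?_⟩
  have hL8 : ell D ≤ ell D ^ 8 := by
    calc ell D = ell D ^ 1 := (pow_one _).symm
      _ ≤ ell D ^ 8 := pow_le_pow_right₀ h1 (by norm_num)
  calc K / ell D ^ 8 ≤ K / ell D := div_le_div_of_nonneg_left hK hLpos hL8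
    _ ≤ ε := by
        rw [div_le_iff₀ hLpos]
        have := (div_le_iff₀ hε).mp h2
        linarith

/-- `‖r·i‖ = |r|` for real `r`. [folklore] -/
private theorem norm_real_mul_I (r : ℝ) : ‖(r : ℂ) * I‖ = |r| := by
  rw [norm_mul, Complex.norm_I, mul_one, Complex.norm_real, Real.norm_eq_abs]

/-- The common last step of the limit nodes: `|r c′ (π/𝓛⁸) π| ≤ ε` from `|r| ≤ K` and
`K|c′|π²/𝓛⁸ ≤ ε`. [folklore] -/
private theorem tail_bound {r K c L8 ε : ℝ} (hr : |r| ≤ K) (hL8 : 0 < L8)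
    (hK : K * |c| * π * π / L8 ≤ ε) : |r * c * (π / L8) * π| ≤ ε := by
  rw [abs_mul, abs_mul, abs_mul, abs_div, abs_of_pos Real.pi_pos, abs_of_pos hL8]
  have hx : 0 ≤ |c| * (π / L8) * π := by positivity
  calc |r| * |c| * (π / L8) * π = |r| * (|c| * (π / L8) * π) := by ring
    _ ≤ K * (|c| * (π / L8) * π) := mul_le_mul_of_nonneg_right hr hx
    _ = K * |c| * π * π / L8 := by ring
    _ ≤ ε := hK

/-- A real (quadratic) character is fixed by complex conjugation. [folklore] -/
private theorem conj_apply_of_isQuadratic {D : ℕ} {χ : DirichletCharacter ℂ D} (hq : χ.IsQuadratic)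
    (a : ZMod D) : conj (χ a) = χ a := by
  rcases hq a with h | h | h <;> simp [h]

/-- For a real character, `χ(a)² = |χ(a)|`. [folklore] -/
private theorem mul_self_of_isQuadratic {D : ℕ} {χ : DirichletCharacter ℂ D} (hq : χ.IsQuadratic)
    (a : ZMod D) : χ a * χ a = (‖χ a‖ : ℂ) := by
  rcases hq a with h | h | h <;> simp [h]

variable (c' : ℝ)

/-- **`Z22:§12.u035` holds**: the expansion of `S_j(𝐚₁₂,𝐚₂₅)` is an identity (`χ(drm) = χ(d)χ(r)χ(m)`,
`χ² = |χ|`, `χ̄ = χ` for the real character `χ`). [cite: Zhang2022LandauSiegel, §12 (12.12) p.71] -/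
theorem step12u035_holds : Step12u035 c' := by
  refine ⟨0, fun D _ χ _ hq _ a25 ha25 j _ => ?_⟩
  unfold Sj sj1225rhs
  refine Finset.sum_congr rfl fun d _ => Finset.sum_congr rfl fun r _ => ?_
  have hM : (∑ m ∈ Finset.Ico 1 (Nsupp D), a12 χ (d * r * m) / (m : ℂ) ^ (1 - betaJ c' D j)) =
      χ (d : ZMod D) * χ (r : ZMod D) * ∑ m ∈ Finset.Ico 1 (Nsupp D), χ (m : ZMod D) *
        (conj iota3 * vk3 D (d * r * m) + conj iota4 * vk2 D (d * r * m)) /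
          (m : ℂ) ^ (1 - betaJ c' D j) := by
    rw [Finset.mul_sum]
    refine Finset.sum_congr rfl fun m _ => ?_
    simp only [a12, Nat.cast_mul, map_mul]
    ring
  have hN : (∑ n ∈ Finset.Ico 1 (Nsupp D), a25 (d * r * n) * xiZero c' D j n d r / (n : ℂ)) =
      χ (d : ZMod D) * χ (r : ZMod D) * ∑ n ∈ Finset.Ico 1 (Nsupp D), χ (n : ZMod D) *
        conj (vk13 D (d * r * n)) * xiZero c' D j n d r / (n : ℂ) := by
    rw [Finset.mul_sum]
    refine Finset.sum_congr rfl fun n _ => ?_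
    rw [ha25]
    simp only [Nat.cast_mul, map_mul, conj_apply_of_isQuadratic hq]
    ring
  rw [hM, hN, ← mul_self_of_isQuadratic hq (d : ZMod D), ← mul_self_of_isQuadratic hq (r : ZMod D)]
  ring

/-- `Step12u035` — `_holds` alias of `step12u035_holds` above under the fact's exact name (appended
2026-08-28, D-0026 bookkeeping: the proof term is the existing theorem of this file; no statement,
definition or attribute is edited; no new named fact; the ledger's debt table listed the fact
unproved). [cite: Zhang2022LandauSiegel, §12 (12.12) p.71] -/
theorem _root_.Literature.NumberTheory.LFunctions.Zhang2022.Typed.Sec12C.Step12u035_holds :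
    Step12u035 c' :=
  _root_.Literature.NumberTheory.LFunctions.Zhang2022.Typed.Sec12C.step12u035_holds (c' := c')

/-- **`Z22:§12.u047` holds**: the expansion of `S_j(𝐚₁₅,𝐚₂₂)` is an identity.
[cite: Zhang2022LandauSiegel, §12 (12.16) p.73] -/
theorem step12u047_holds : Step12u047 c' := by
  refine ⟨0, fun D _ χ _ hq _ a15 ha15 j _ => ?_⟩
  unfold Sj sj1522rhs
  refine Finset.sum_congr rfl fun d _ => Finset.sum_congr rfl fun r _ => ?_
  have hM : (∑ m ∈ Finset.Ico 1 (Nsupp D), a15 (d * r * m) / (m : ℂ) ^ (1 - betaJ c' D j)) =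
      χ (d : ZMod D) * χ (r : ZMod D) * ∑ m ∈ Finset.Ico 1 (Nsupp D), χ (m : ZMod D) *
        vk13 D (d * r * m) / (m : ℂ) ^ (1 - betaJ c' D j) := by
    rw [Finset.mul_sum]
    refine Finset.sum_congr rfl fun m _ => ?_
    rw [ha15]
    simp only [Nat.cast_mul, map_mul]
    ring
  have hN : (∑ n ∈ Finset.Ico 1 (Nsupp D), a22 χ (d * r * n) * xiZero c' D j n d r / (n : ℂ)) =
      χ (d : ZMod D) * χ (r : ZMod D) * ∑ n ∈ Finset.Ico 1 (Nsupp D), χ (n : ZMod D) *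
        (iota3 * conj (vk3 D (d * r * n)) + iota4 * conj (vk2 D (d * r * n))) *
          xiZero c' D j n d r / (n : ℂ) := by
    rw [Finset.mul_sum]
    refine Finset.sum_congr rfl fun n _ => ?_
    simp only [a22, a12, Nat.cast_mul, map_mul, map_add, Complex.conj_conj,
      conj_apply_of_isQuadratic hq]
    ring
  rw [hM, hN, ← mul_self_of_isQuadratic hq (d : ZMod D), ← mul_self_of_isQuadratic hq (r : ZMod D)]
  ring

/-- `Step12u047` — `_holds` alias of `step12u047_holds` above under the fact's exact name (appended
2026-08-28, D-0026 bookkeeping: the proof term is the existing theorem of this file; no statement,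
definition or attribute is edited; no new named fact; the ledger's debt table listed the fact
unproved). [cite: Zhang2022LandauSiegel, §12 (12.16) p.73] -/
theorem _root_.Literature.NumberTheory.LFunctions.Zhang2022.Typed.Sec12C.Step12u047_holds :
    Step12u047 c' :=
  _root_.Literature.NumberTheory.LFunctions.Zhang2022.Typed.Sec12C.step12u047_holds (c' := c')

/-- **`Z22:§12.u051` holds**: `𝔤𝔥_{jμ}(0) = 1`, `𝔤𝔥′_{jμ}(0) = −(2k_μ − k_{j+1} − k_{j+2})πi` for the six
pairs ((8.13)–(8.18)), and `(2β_μ − β_{j+1} − β_{j+2})log P − (2k_μ − k_{j+1} − k_{j+2})πi = r c′π²𝓛⁻⁸·i → 0`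
(`r ∈ {1, 8, 3}` by case; exact algebra of (2.13), (2.22) with `α log P = π`, `α𝓛 = π𝓛⁻⁸`).
[cite: Zhang2022LandauSiegel, §12 (12.16) p.73] -/
theorem step12u051_holds : Step12u051 c' := by
  refine ⟨?_, ?_⟩
  · intro j hj μ hμ
    simp only [Finset.mem_insert, Finset.mem_singleton] at hj hμ
    rcases hj with rfl | rfl | rfl <;> rcases hμ with rfl | rfl <;>
      exact ⟨by norm_num [ghj, gh16, gh26, gh36, gh17, gh27, gh37, ghF_apply_zero],
        (hasDerivAt_ghF_zero _ _ _ _).congr_deriv (by norm_num [slope])⟩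
  · intro ε hε
    obtain ⟨D₀, hD₀⟩ := ell_large (8 * |c'| * π * π) ε (by positivity) hε
    refine ⟨D₀, fun D _ χ hD _ _ => ?_⟩
    obtain ⟨hL1, hK⟩ := hD₀ D hD
    have hA : ((alpha D : ℝ) : ℂ) * (Real.log (bigP D) : ℝ) = (π : ℂ) := by
      rw [← Complex.ofReal_mul, alpha_mul_log_bigP D hL1]
    have h8 : 0 < ell D ^ 8 := pow_pos (by linarith) 8
    intro j hj μ hμ
    simp only [Finset.mem_insert, Finset.mem_singleton] at hj hμ
    rcases hj with rfl | rfl | rfl <;> rcases hμ with rfl | rfl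
    · have key : (2 * betaMu D 6 - betaJ c' D (1 + 1) - betaJ c' D (1 + 2)) * (Real.log (bigP D) : ℂ) -
            (2 * slope 6 - slope (1 + 1) - slope (1 + 2)) * π * I =
          ((1 * c' * (alpha D * ell D) * π : ℝ) : ℂ) * I := by
        norm_num only [betaMu, betaJ, slope, beta6, beta7, beta1, beta2, beta3]
        push_cast
        linear_combination (I * (-2 + (c' : ℂ) * (alpha D : ℂ) * (ell D : ℂ))) * hA
      rw [key, norm_real_mul_I, alpha_mul_ell D hL1]
      exact tail_bound (by norm_num) h8 hK
    · have key : (2 * betaMu D 7 - betaJ c' D (1 + 1) - betaJ c' D (1 + 2)) * (Real.log (bigP D) : ℂ) -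
            (2 * slope 7 - slope (1 + 1) - slope (1 + 2)) * π * I =
          ((1 * c' * (alpha D * ell D) * π : ℝ) : ℂ) * I := by
        norm_num only [betaMu, betaJ, slope, beta6, beta7, beta1, beta2, beta3]
        push_cast
        linear_combination (I * ((c' : ℂ) * (alpha D : ℂ) * (ell D : ℂ))) * hA
      rw [key, norm_real_mul_I, alpha_mul_ell D hL1]
      exact tail_bound (by norm_num) h8 hK
    · have key : (2 * betaMu D 6 - betaJ c' D (2 + 1) - betaJ c' D (2 + 2)) * (Real.log (bigP D) : ℂ) -
            (2 * slope 6 - slope (2 + 1) - slope (2 + 2)) * π * I =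
          ((8 * c' * (alpha D * ell D) * π : ℝ) : ℂ) * I := by
        norm_num only [betaMu, betaJ, slope, beta6, beta7, beta1, beta2, beta3]
        push_cast
        linear_combination (I * (-1 + 8 * (c' : ℂ) * (alpha D : ℂ) * (ell D : ℂ))) * hA
      rw [key, norm_real_mul_I, alpha_mul_ell D hL1]
      exact tail_bound (by norm_num) h8 hK
    · have key : (2 * betaMu D 7 - betaJ c' D (2 + 1) - betaJ c' D (2 + 2)) * (Real.log (bigP D) : ℂ) -
            (2 * slope 7 - slope (2 + 1) - slope (2 + 2)) * π * I =
          ((8 * c' * (alpha D * ell D) * π : ℝ) : ℂ) * I := by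
        norm_num only [betaMu, betaJ, slope, beta6, beta7, beta1, beta2, beta3]
        push_cast
        linear_combination (I * (1 + 8 * (c' : ℂ) * (alpha D : ℂ) * (ell D : ℂ))) * hA
      rw [key, norm_real_mul_I, alpha_mul_ell D hL1]
      exact tail_bound (by norm_num) h8 hK
    · have key : (2 * betaMu D 6 - betaJ c' D (3 + 1) - betaJ c' D (3 + 2)) * (Real.log (bigP D) : ℂ) -
            (2 * slope 6 - slope (3 + 1) - slope (3 + 2)) * π * I =
          ((3 * c' * (alpha D * ell D) * π : ℝ) : ℂ) * I := by
        norm_num only [betaMu, betaJ, slope, beta6, beta7, beta1, beta2, beta3]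
        push_cast
        linear_combination (I * (3 * (c' : ℂ) * (alpha D : ℂ) * (ell D : ℂ))) * hA
      rw [key, norm_real_mul_I, alpha_mul_ell D hL1]
      exact tail_bound (by norm_num) h8 hK
    · have key : (2 * betaMu D 7 - betaJ c' D (3 + 1) - betaJ c' D (3 + 2)) * (Real.log (bigP D) : ℂ) -
            (2 * slope 7 - slope (3 + 1) - slope (3 + 2)) * π * I =
          ((3 * c' * (alpha D * ell D) * π : ℝ) : ℂ) * I := by
        norm_num only [betaMu, betaJ, slope, beta6, beta7, beta1, beta2, beta3]
        push_cast
        linear_combination (I * (2 + 3 * (c' : ℂ) * (alpha D : ℂ) * (ell D : ℂ))) * hA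
      rw [key, norm_real_mul_I, alpha_mul_ell D hL1]
      exact tail_bound (by norm_num) h8 hK

/-- `Step12u051` — `_holds` alias of `step12u051_holds` above under the fact's exact name (appended
2026-08-28, D-0026 bookkeeping: the proof term is the existing theorem of this file; no statement,
definition or attribute is edited; no new named fact; the ledger's debt table listed the fact
unproved). [cite: Zhang2022LandauSiegel, §12 (12.16) p.73] -/
theorem _root_.Literature.NumberTheory.LFunctions.Zhang2022.Typed.Sec12C.Step12u051_holds :
    Step12u051 c' :=
  _root_.Literature.NumberTheory.LFunctions.Zhang2022.Typed.Sec12C.step12u051_holds (c' := c')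

/-- `Z22:(12.14)` bookkeeping (PROVED): the printed main term of (12.14) is `𝔞αe₂*/4` (the bracket of
(12.14) is `(0.504π/4)e₂*` by the definition of `e₂*`, display after (12.15); `α = π/log P`).
[cite: Zhang2022LandauSiegel, §12 (12.14)–(12.15) p.72] -/
theorem main1214_eq {D : ℕ} [NeZero D] (χ : DirichletCharacter ℂ D) :
    main1214 χ = frakA χ * alpha D * e2star / 4 := by
  rw [main1214, e2star, alpha]
  by_cases h : Real.log (bigP D) = 0
  · simp [h]
  · have h' : (Real.log (bigP D) : ℂ) ≠ 0 := by exact_mod_cast h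
    have hπ : (π : ℂ) ≠ 0 := by exact_mod_cast Real.pi_ne_zero
    push_cast
    field_simp

end Discharges

end Literature.NumberTheory.LFunctions.Zhang2022.Typed.Sec12C
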